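import Mathlib
import Summits.NavierStokesRegularity.NavierStokesRegularity.Theses.PoloidalWindowDoor

/-!
# Crux `PoloidalWindowRigidity` (stmt-NavierStokesRegularity-19708) — strategist g6 census sketch (typed statements only)

Typed companions of `STRATEGY-CENSUS-g6.md` (seat cstrat-stmt-NavierStokesRegularity-19708-g6).
Nothing here is a route item or a registered stub; the `def … : Prop` are the signatures the census refers to.

* `KinematicGlobalRigidityThick` (census §Negation N6, the "(M)-light" question KGR): no bounded entire `C²` divergence-free
  HORIZONTAL-VORTICITY field obeying only the SLOPE RELATION `ω·∇u₂ = 0` (the one first-order shadow of the momentum equation)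
  carries a non-degenerate twisting HYPERBOLIC-THICK window.  A proof would close `mixed_type.stub_hyperbolicThick` outright;
  the census argues it is probably FALSE (formal deformation of a thick axisymmetric column is unobstructed at second order) and
  hands it to the disprover as the sharpest `_false_without_` class still open (K-50 `thickProfile` has no slope function at all,
  the log-twist germ is local and unbounded).
* `UniformlyHyperbolicThickRegular` (census §Strengthen S⁺₆): the Lax–John target — one slice on which the shear ratio `Λ`
  is defined everywhere and pinched in `[-Λ₁, -Λ₀]`, `Λ₀ > 0`, plus a thick twisting window in that slice, is regular.
  Confinement of the Riccati variable only; not claimed.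
* `AutonomousThickRegular` (census §Strengthen S⁺₇): the thick window whose structure function has no explicit height dependence
  (`∂₂vₕ = g(t, v₂) ∇ₕv₂` on the window).  Removes the `Λ_z`-forcing from the Riccati law but not the leaf-curvature forcing; not claimed.

Every statement about class profiles keeps the mild/Duhamel binder (M) — honouring
`…Negative.HyperbolicThickFalseWithoutMild.hyperbolicThick_false_without_mild`,
`…Negative.SemiEllipticThickFalseWithoutMild.semiEllipticThick_false_without_mild`,
`…LrcModEntire.Negative.TwistingThickFalseWithoutMild.twistingThick_false_without_mild`.
`KinematicGlobalRigidityThick` deliberately drops (M) down to the slope relation and is recorded as a QUESTION, not a stub.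

WHAT THIS IS NOT: not a claim about Navier–Stokes regularity; not a line; not a proof of the crux.
-/

namespace Summit.NavierStokesRegularity.NavierStokesRegularity.Cruxes.PoloidalWindowRigidity.CensusG6

set_option linter.dupNamespace false
open scoped RealInnerProductSpace InnerProductSpace

/-- KGR — KINEMATIC GLOBAL RIGIDITY OF THE THICK STRATUM, (M)-light form (census §Negation N6).
For a `C²` field `u : ℝ³ → ℝ³` with `u`, `Du` bounded, `div u = 0`, horizontal vorticity (`curl u ⊥ e₂`), and the slope
relation `ω·∇u₂ = 0`, there is NO nonempty open set on which `u` is non-degenerate (`curl u ≠ 0`, `∇ₕu₂ ≠ 0`, `∂₂uₕ ≠ 0`),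
twisting (`{∂₂u₂, u₂}ₕ ≠ 0`), hyperbolic (`⟪∂₂uₕ, ∇ₕu₂⟫ < 0`) and THICK (the slope `∂₂u_b / ∂_bu₂` is a function of the height
`x₂` alone on no open subset).  Expected FALSE; a kernel witness would be the (M)-light `_false_without_` fact for every thick stub. -/
def KinematicGlobalRigidityThick : Prop :=
  ∀ u : EuclideanSpace ℝ (Fin 3) → EuclideanSpace ℝ (Fin 3),
    ContDiff ℝ 2 u →
    (∃ M : ℝ, ∀ x, ‖u x‖ ≤ M ∧ ‖fderiv ℝ u x‖ ≤ M) →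
    Literature.Analysis.FluidPDE.VectorCalculus.IsDivFree u →
    (∀ y, ⟪Literature.Analysis.FluidPDE.curl u y, EuclideanSpace.single 2 1⟫_ℝ = 0) →
    (∀ y, fderiv ℝ (fun x => u x 2) y (Literature.Analysis.FluidPDE.curl u y) = 0) →
    ∀ W : Set (EuclideanSpace ℝ (Fin 3)), IsOpen W → W.Nonempty →
      (∀ y ∈ W, Literature.Analysis.FluidPDE.curl u y ≠ 0 ∧
        (fderiv ℝ u y (EuclideanSpace.single 0 1) 2 ≠ 0 ∨ fderiv ℝ u y (EuclideanSpace.single 1 1) 2 ≠ 0) ∧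
        (fderiv ℝ u y (EuclideanSpace.single 2 1) 0 ≠ 0 ∨ fderiv ℝ u y (EuclideanSpace.single 2 1) 1 ≠ 0)) →
      (∀ y ∈ W,
        fderiv ℝ (fun x => fderiv ℝ u x (EuclideanSpace.single 2 1) 2) y (EuclideanSpace.single 0 1) *
            fderiv ℝ u y (EuclideanSpace.single 1 1) 2 -
          fderiv ℝ (fun x => fderiv ℝ u x (EuclideanSpace.single 2 1) 2) y (EuclideanSpace.single 1 1) *
            fderiv ℝ u y (EuclideanSpace.single 0 1) 2 ≠ 0) →
      (∀ y ∈ W,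
        fderiv ℝ u y (EuclideanSpace.single 2 1) 0 * fderiv ℝ u y (EuclideanSpace.single 0 1) 2 +
          fderiv ℝ u y (EuclideanSpace.single 2 1) 1 * fderiv ℝ u y (EuclideanSpace.single 1 1) 2 < 0) →
      (∀ m : ℝ → ℝ, ∀ W₁ : Set (EuclideanSpace ℝ (Fin 3)), W₁ ⊆ W → IsOpen W₁ → W₁.Nonempty →
        ∃ y ∈ W₁, ∃ b : Fin 3, b ≠ 2 ∧
          fderiv ℝ u y (EuclideanSpace.single 2 1) b ≠ m (y 2) * fderiv ℝ u y (EuclideanSpace.single b 1) 2) →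
      False

/-- S⁺₆ — UNIFORMLY HYPERBOLIC-THICK SLICE (census §Strengthen; the Lax–John target).  Class binders with (M), globally poloidal
along `e₂`; a space–time window `W` that is non-degenerate, twisting and thick (clauses as in `mixed_type.stub_hyperbolicThick`);
and ONE time `t` meeting `W` at which a shear ratio `Λ` exists at EVERY point (`∂₂v_b = Λ ∂_bv₂`, `b = 0, 1`) with
`-Λ₁ ≤ Λ ≤ -Λ₀ < 0` on all of `ℝ³` — then the apex is regular.  (Confinement of the Riccati variable along complete bicharacteristics
is all the kinematics gives; the sign of the forcing is the open point; mixed type along vertical lines is generic, so the hypothesis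
is also unnatural.)  Not claimed. -/
def UniformlyHyperbolicThickRegular : Prop :=
  ∀ (C : ℝ) (v : ℝ → EuclideanSpace ℝ (Fin 3) → EuclideanSpace ℝ (Fin 3)),
    Literature.Analysis.FluidPDE.HasTypeITimeDecay C v →
    ContinuousOn (Function.uncurry v) (Set.Iio (0 : ℝ) ×ˢ Set.univ) →
    (∀ s t : ℝ, s < t → t < 0 → ∀ x, v t x =
      Literature.Analysis.UnboundedOperators.heatExtension (v s) (t - s) x -
        Literature.Analysis.FluidPDE.oseenDuhamel 1 s v v t x) →
    (∀ t < 0, Literature.Analysis.FluidPDE.VectorCalculus.IsDivFree (v t)) →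
    (∀ s < 0, ∀ y, ⟪Literature.Analysis.FluidPDE.curl (v s) y, EuclideanSpace.single 2 1⟫_ℝ = 0) →
    ∀ W : Set (ℝ × EuclideanSpace ℝ (Fin 3)), IsOpen W → W.Nonempty → W ⊆ Set.Iio (0 : ℝ) ×ˢ Set.univ →
      (∀ z ∈ W, Literature.Analysis.FluidPDE.curl (v z.1) z.2 ≠ 0 ∧
        (fderiv ℝ (v z.1) z.2 (EuclideanSpace.single 0 1) 2 ≠ 0 ∨ fderiv ℝ (v z.1) z.2 (EuclideanSpace.single 1 1) 2 ≠ 0) ∧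
        (fderiv ℝ (v z.1) z.2 (EuclideanSpace.single 2 1) 0 ≠ 0 ∨ fderiv ℝ (v z.1) z.2 (EuclideanSpace.single 2 1) 1 ≠ 0)) →
      (∀ z ∈ W,
        fderiv ℝ (fun x => fderiv ℝ (v z.1) x (EuclideanSpace.single 2 1) 2) z.2 (EuclideanSpace.single 0 1) *
            fderiv ℝ (v z.1) z.2 (EuclideanSpace.single 1 1) 2 -
          fderiv ℝ (fun x => fderiv ℝ (v z.1) x (EuclideanSpace.single 2 1) 2) z.2 (EuclideanSpace.single 1 1) *
            fderiv ℝ (v z.1) z.2 (EuclideanSpace.single 0 1) 2 ≠ 0) →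
      (∀ m : ℝ → ℝ → ℝ, ∀ W₁ : Set (ℝ × EuclideanSpace ℝ (Fin 3)), W₁ ⊆ W → IsOpen W₁ → W₁.Nonempty →
        ∃ z ∈ W₁, ∃ b : Fin 3, b ≠ 2 ∧
          fderiv ℝ (v z.1) z.2 (EuclideanSpace.single 2 1) b ≠
            m z.1 (z.2 2) * fderiv ℝ (v z.1) z.2 (EuclideanSpace.single b 1) 2) →
      (∃ t : ℝ, t < 0 ∧ (∃ y, (t, y) ∈ W) ∧
        ∃ Λ : EuclideanSpace ℝ (Fin 3) → ℝ, ∃ Λ₀ Λ₁ : ℝ, 0 < Λ₀ ∧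
          (∀ y, ∀ b : Fin 3, b ≠ 2 →
            fderiv ℝ (v t) y (EuclideanSpace.single 2 1) b = Λ y * fderiv ℝ (v t) y (EuclideanSpace.single b 1) 2) ∧
          (∀ y, -Λ₁ ≤ Λ y ∧ Λ y ≤ -Λ₀)) →
      ¬ Literature.Analysis.FluidPDE.IsBackwardSingularPoint v 0

/-- S⁺₇ — AUTONOMOUS THICK WINDOW (census §Strengthen).  As `mixed_type.stub_hyperbolicThick` (class binders with (M), globally
poloidal, non-degenerate twisting hyperbolic window, thick = slope a function of `(t, x₂)` on no sub-window) PLUS: on the window the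
slope is a function of `(t, v₂)` alone — `∂₂v_b = g t (v₂) · ∂_bv₂` — i.e. the structure function has no explicit height dependence.
Then the apex is regular.  Not claimed (the Riccati forcing keeps its leaf-curvature term). -/
def AutonomousThickRegular : Prop :=
  ∀ (C : ℝ) (v : ℝ → EuclideanSpace ℝ (Fin 3) → EuclideanSpace ℝ (Fin 3)),
    Literature.Analysis.FluidPDE.HasTypeITimeDecay C v →
    ContinuousOn (Function.uncurry v) (Set.Iio (0 : ℝ) ×ˢ Set.univ) →
    (∀ s t : ℝ, s < t → t < 0 → ∀ x, v t x =
      Literature.Analysis.UnboundedOperators.heatExtension (v s) (t - s) x -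
        Literature.Analysis.FluidPDE.oseenDuhamel 1 s v v t x) →
    (∀ t < 0, Literature.Analysis.FluidPDE.VectorCalculus.IsDivFree (v t)) →
    (∀ s < 0, ∀ y, ⟪Literature.Analysis.FluidPDE.curl (v s) y, EuclideanSpace.single 2 1⟫_ℝ = 0) →
    ∀ W : Set (ℝ × EuclideanSpace ℝ (Fin 3)), IsOpen W → W.Nonempty → W ⊆ Set.Iio (0 : ℝ) ×ˢ Set.univ →
      (∀ z ∈ W, Literature.Analysis.FluidPDE.curl (v z.1) z.2 ≠ 0 ∧
        (fderiv ℝ (v z.1) z.2 (EuclideanSpace.single 0 1) 2 ≠ 0 ∨ fderiv ℝ (v z.1) z.2 (EuclideanSpace.single 1 1) 2 ≠ 0) ∧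
        (fderiv ℝ (v z.1) z.2 (EuclideanSpace.single 2 1) 0 ≠ 0 ∨ fderiv ℝ (v z.1) z.2 (EuclideanSpace.single 2 1) 1 ≠ 0)) →
      (∀ z ∈ W,
        fderiv ℝ (fun x => fderiv ℝ (v z.1) x (EuclideanSpace.single 2 1) 2) z.2 (EuclideanSpace.single 0 1) *
            fderiv ℝ (v z.1) z.2 (EuclideanSpace.single 1 1) 2 -
          fderiv ℝ (fun x => fderiv ℝ (v z.1) x (EuclideanSpace.single 2 1) 2) z.2 (EuclideanSpace.single 1 1) *
            fderiv ℝ (v z.1) z.2 (EuclideanSpace.single 0 1) 2 ≠ 0) →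
      (∀ z ∈ W,
        fderiv ℝ (v z.1) z.2 (EuclideanSpace.single 2 1) 0 * fderiv ℝ (v z.1) z.2 (EuclideanSpace.single 0 1) 2 +
          fderiv ℝ (v z.1) z.2 (EuclideanSpace.single 2 1) 1 * fderiv ℝ (v z.1) z.2 (EuclideanSpace.single 1 1) 2 < 0) →
      (∀ m : ℝ → ℝ → ℝ, ∀ W₁ : Set (ℝ × EuclideanSpace ℝ (Fin 3)), W₁ ⊆ W → IsOpen W₁ → W₁.Nonempty →
        ∃ z ∈ W₁, ∃ b : Fin 3, b ≠ 2 ∧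
          fderiv ℝ (v z.1) z.2 (EuclideanSpace.single 2 1) b ≠
            m z.1 (z.2 2) * fderiv ℝ (v z.1) z.2 (EuclideanSpace.single b 1) 2) →
      (∃ g : ℝ → ℝ → ℝ, ∀ z ∈ W, ∀ b : Fin 3, b ≠ 2 →
        fderiv ℝ (v z.1) z.2 (EuclideanSpace.single 2 1) b =
          g z.1 (v z.1 z.2 2) * fderiv ℝ (v z.1) z.2 (EuclideanSpace.single b 1) 2) →
      ¬ Literature.Analysis.FluidPDE.IsBackwardSingularPoint v 0

end Summit.NavierStokesRegularity.NavierStokesRegularity.Cruxes.PoloidalWindowRigidity.CensusG6
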